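import Literature.Analysis.FunctionSpaces.TorusSpaceTime
import Literature.Analysis.FunctionSpaces.HolderNorm
import HarnessLib

/-!
# Continuity in time of the sup norm of a jointly smooth field on the torus

Trunk: Sobolev (`Literature/Analysis/FunctionSpaces`). Support lemmas for the perturbation step
of M. P. Coiculescu, S. Palasek, *Non-uniqueness of smooth solutions of the Navier–Stokes
equations from critical data*, Invent. Math. 244 (2025) = arXiv:2503.14699: the lacunarity
hypothesis (3.13b) of Prop. 3.13 is an integral in time of the envelope `t ↦ ‖v(t)‖_{L^∞}`, and
the layer estimate of Prop. 4.2 (tree: `LacunaryCoeff`) consumes this envelope as a continuous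
function of time. For a field jointly smooth on `S × 𝕋ᵈ` (compact torus) the sup norm
`eSupNorm (v t) = ⨆ₓ ‖v t x‖ₑ` is finite and `t ↦ (eSupNorm (v t)).toReal` is continuous on `S`
(tube lemma `Torus.IsSmoothSpaceTimeOn.eventually_norm_sub_lt`):

* `Torus.eSupNorm_lt_top_of_continuous`, `Torus.norm_le_toReal_eSupNorm`;
* `Torus.eSupNorm_le_add_of_forall_norm_sub_le` — `‖f‖_∞ ≤ ‖g‖_∞ + ε` if `‖f x - g x‖ ≤ ε`;
* `Torus.IsSmoothSpaceTimeOn.continuousOn_toReal_eSupNorm`.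

## References

* M. P. Coiculescu, S. Palasek, Invent. Math. 244 (2025) = arXiv:2503.14699, Prop. 3.13 (3.13b),
  Prop. 4.2. [`CoiculescuPalasek2025`]
-/

noncomputable section

open MeasureTheory Set Filter Topology Function
open scoped ENNReal NNReal

namespace Literature.Analysis.FunctionSpaces

namespace Torus

variable {d : Type*} [Fintype d]
variable {F : Type*} [NormedAddCommGroup F]

omit [Fintype d] in
/-- A continuous function on the compact torus has finite sup norm. [folklore] -/
theorem eSupNorm_lt_top_of_continuous {f : UnitAddTorus d → F} (hf : Continuous f) :
    eSupNorm f < ∞ :=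
  eSupNorm_lt_top_iff.2 (hf.bounded_above_of_compact_support (HasCompactSupport.of_compactSpace f))

omit [Fintype d] in
/-- Pointwise values are bounded by the (finite) sup norm: `‖f x‖ ≤ (eSupNorm f).toReal` for
continuous `f` on the torus. [folklore] -/
theorem norm_le_toReal_eSupNorm {f : UnitAddTorus d → F} (hf : Continuous f) (x : UnitAddTorus d) :
    ‖f x‖ ≤ (eSupNorm f).toReal := by
  have h := ENNReal.toReal_mono (eSupNorm_lt_top_of_continuous hf).ne (enorm_le_eSupNorm f x)
  simpa using h

omit [Fintype d] in
/-- `‖f‖_∞ ≤ ‖g‖_∞ + ε` when `‖f x - g x‖ ≤ ε` for all `x`. [folklore] -/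
theorem eSupNorm_le_add_of_forall_norm_sub_le {X : Type*} {f g : X → F} {ε : ℝ} (hε : 0 ≤ ε)
    (h : ∀ x, ‖f x - g x‖ ≤ ε) : eSupNorm f ≤ eSupNorm g + ENNReal.ofReal ε := by
  refine iSup_le fun x => ?_
  have h1 : ‖f x‖ ≤ ‖g x‖ + ε := by
    calc ‖f x‖ = ‖g x + (f x - g x)‖ := by rw [add_sub_cancel]
      _ ≤ ‖g x‖ + ‖f x - g x‖ := norm_add_le _ _
      _ ≤ ‖g x‖ + ε := by gcongr; exact h x
  calc ‖f x‖ₑ = ENNReal.ofReal ‖f x‖ := (ofReal_norm _).symm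
    _ ≤ ENNReal.ofReal (‖g x‖ + ε) := ENNReal.ofReal_le_ofReal h1
    _ = ‖g x‖ₑ + ENNReal.ofReal ε := by rw [ENNReal.ofReal_add (norm_nonneg _) hε, ofReal_norm]
    _ ≤ eSupNorm g + ENNReal.ofReal ε := by gcongr; exact enorm_le_eSupNorm g x

variable [NormedSpace ℝ F]

/-- **The sup norm of a jointly smooth field is continuous in time**: for `u` jointly smooth on
`S × 𝕋ᵈ`, `t ↦ (eSupNorm (u t)).toReal` is continuous on `S` (by the tube lemma over the compact
torus, `‖u s - u t‖_∞ → 0` as `s → t` within `S`, and `|‖u s‖_∞ - ‖u t‖_∞| ≤ ‖u s - u t‖_∞`).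
[folklore] -/
theorem IsSmoothSpaceTimeOn.continuousOn_toReal_eSupNorm {S : Set ℝ} {u : ℝ → UnitAddTorus d → F}
    (hu : IsSmoothSpaceTimeOn S u) : ContinuousOn (fun t => (eSupNorm (u t)).toReal) S := by
  intro t ht
  have hcont : ∀ s ∈ S, Continuous (u s) := fun s hs => (hu.isSmooth_slice hs).continuous
  rw [ContinuousWithinAt, Metric.tendsto_nhds]
  intro ε hε
  have hε2 : 0 < ε / 2 := half_pos hε
  filter_upwards [hu.eventually_norm_sub_lt ht hε2, self_mem_nhdsWithin] with s hs hsS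
  have hs' : ∀ x, ‖u s x - u t x‖ ≤ ε / 2 := fun x => (hs x).le
  have ht' : ∀ x, ‖u t x - u s x‖ ≤ ε / 2 := fun x => by rw [norm_sub_rev]; exact (hs x).le
  have h1 := eSupNorm_le_add_of_forall_norm_sub_le hε2.le hs'
  have h2 := eSupNorm_le_add_of_forall_norm_sub_le hε2.le ht'
  have hfs := (eSupNorm_lt_top_of_continuous (hcont s hsS)).ne
  have hft := (eSupNorm_lt_top_of_continuous (hcont t ht)).ne
  have h1' : (eSupNorm (u s)).toReal ≤ (eSupNorm (u t)).toReal + ε / 2 := by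
    have := ENNReal.toReal_mono (ENNReal.add_ne_top.2 ⟨hft, ENNReal.ofReal_ne_top⟩) h1
    rwa [ENNReal.toReal_add hft ENNReal.ofReal_ne_top, ENNReal.toReal_ofReal hε2.le] at this
  have h2' : (eSupNorm (u t)).toReal ≤ (eSupNorm (u s)).toReal + ε / 2 := by
    have := ENNReal.toReal_mono (ENNReal.add_ne_top.2 ⟨hfs, ENNReal.ofReal_ne_top⟩) h2
    rwa [ENNReal.toReal_add hfs ENNReal.ofReal_ne_top, ENNReal.toReal_ofReal hε2.le] at this
  rw [Real.dist_eq, abs_lt]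
  constructor <;> linarith

end Torus

end Literature.Analysis.FunctionSpaces
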